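import Summits.QuantumFields.YangMills.Theorems.IR.BlockedActivityWStrongCouplingKR
import Summits.Ventures.YMGap.RobustBall.BoundaryFactorLipschitz
import HarnessLib

/-!
# Crux `IR` (stmt-QuantumFields-19354), lane B «strong coupling AFTER BLOCKING»: `SU(N)` — the class of record at EVERY mesh from ANY one-link
# Kantorovich–Rubinstein modulus (the single-link Frobenius-weight Dobrushin doors of the venture `YMGap`)

Helper module for item `stmt-QuantumFields-19354` (`--supports`; it closes nothing), lane `ym-19354-onsetsc-p2` (g5).

WHAT IS HERE (all proved; `SU(N)` lattice Yang–Mills on `ℤ⁴` with the Wilson action, 't Hooft coupling `β`, tree coupling `N·β`, i.e. the tree's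
`ymSpecification (fundamentalRep (Fin N)) (N·β)` = `(fundamentalLatticeRep N).ρ` at `N·β`; `SU(2)`: `β_W = 4β`, tree `β_W/2`).

* `isKRContraction_of_oneLinkKRModulus` ∕ `row_sum_of_oneLinkKRModulus` — a one-link modulus `OneLinkKRModulus N R K` on the ball `|β|·6 ≤ R`
  makes the Wilson specification a Kantorovich contraction for the Frobenius weight with coefficients `K|β|·n(x,y)` and row sums `≤ 18K|β|`
  (the `d = 4` case of the construction inside `StrongCouplingDobrushinWindow.dlrMassGap_of_oneLinkKRModulus`, exposed as a theorem);
  `abs_kerInt_sub_le_of_agree_ball_of_oneLinkKRModulus` — the ball form of the general-volume influence engine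
  (`KRInfluence.abs_kerInt_sub_le_of_agree_ball_of_isKRContraction`) at `18K|β| ≤ q < 1`, constant `2√N`.
* `linkRatioSection`, `isLipschitzCylinder_linkRatioSection` — the section of the one-link Boltzmann ratio at an exterior is a Frobenius-Lipschitz
  cylinder on the `≤ 24` links of the plaquettes through the link, constant `48N⁴·|t|·e^{12N|t|}` at tree coupling `t` (the RobustBall
  boundary-factor certificate `suN_isLipschitzCylinder_boundaryFactor` with `B = {a}`, `#P ≤ 6`);  ★ `linkRatio_influence_of_oneLinkKRModulus` —
  THE ANALYTIC INPUT of the lane's chain: two exteriors agreeing within sup-distance `2nb` of the updated link give inner-kernel averages of the link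
  ratio within `2√N · q^{2nb} · 24 · 48N⁴|t|e^{12N|t|}`.
* ★★ `blockedActivityClassW_mesh_of_oneLinkKRModulus` — for `OneLinkKRModulus N R K`, `|β|·6 ≤ R`, `18K|β| ≤ q`, `0 < q < 1`, every mesh `b ≥ 1`,
  window `n ≥ 1`: `BlockedActivityClassW (fundamentalRep (Fin N)) (N·β) b n (sunMeshRadius N (N·β) q b n)`,
  `sunMeshRadius N t q b n = exp(147456 · √N · N⁴ · |t| e^{24N|t|} · b⁴ · q^{2nb}) − 1`; `ratioClauseI_mesh_of_oneLinkKRModulus` (every `Typ`).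
* `sunMeshRadius_le_uniform`, ★ `blockedActivityClassW_eventually_of_oneLinkKRModulus` — for every radius `a > 0`, every `q < 1`: class W at radius
  `a` at ALL large meshes, uniformly on `|β| ≤ β₁` (with `|β₁|·6 ≤ R`, `18K·β₁ ≤ q`); `univShellCond_eventually_…` ∕ `typShellCondUKPc_eventually_…`.

The concrete doors (`SU(2)` quarter modulus: `0 ≤ β_W < 2/9`; `SU(3)` Poincaré × Schwinger–Dyson modulus: `|β| ≤ 1/40`) are the rows of
`Theorems/IR/BlockedActivityWStrongCouplingSUNRows`.

HONEST FRAMING: a strong-coupling (Dobrushin-uniqueness) calibration of the lane's currency of record at every mesh; LATTICE statements, nothing about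
weak coupling, the onset, a gap or Clay.  No `sorry`; axioms ⊆ {propext, Classical.choice, Quot.sound}; no instances, no notation.
Refs: Dobrushin 1970; Föllmer LNM 1362 (1988) Ch. I (2.20); Georgii 2011 Thm. 8.20; Shen–Zhu–Zhu CMP 400 (2023) Rem. after 1.3, Cor. 1.6;
FriedliVelenik2017 §5.7.1.
-/

set_option autoImplicit false

noncomputable section

open MeasureTheory ProbabilityTheory
open Literature.MathematicalPhysics.QuantumFieldTheory hiding ZdEdge Site
open Literature.MathematicalPhysics.QuantumLattice
open Literature.MathematicalPhysics.QuantumFieldTheory.Balaban1983to89.StrongCouplingDobrushinWindow (OneLinkKRModulus)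
open Literature.Probability.LatticeModels Literature.Probability.LatticeModels.DobrushinMetric
open Summit.QuantumFields.YangMills.Cruxes.IR.Tempered (cellEdges windowCells regionEdges collarEdges)
open Summit.QuantumFields.YangMills.Cruxes.IR.CellTempered.Engine (shiftFrame shiftFrame_mesh)
open Summit.QuantumFields.YangMills.Cruxes.IR.OnsetFormats (UnivShellCond)
open Summit.QuantumFields.YangMills.Cruxes.IR.OnsetFormatsUc (TypShellCondUKPc typShellCondUKPc_of_univShellCond)
open Summit.Ventures.YMGap.RobustBall.BoundaryFreeEnergy (suN_isLipschitzCylinder_boundaryFactor)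

namespace Summit.QuantumFields.YangMills.Cruxes.IR.BlockedActivity

namespace SUN

variable {N : ℕ}

/-! ## §1 The Kantorovich contraction of the `SU(N)` Wilson specification from a one-link modulus (`d = 4`) -/

/-- **Dobrushin's condition (Kantorovich form, Frobenius weight) from a one-link modulus, `d = 4`.**  If `OneLinkKRModulus N R K` holds on the
ball `|β|·6 ≤ R` (`β` the 't Hooft coupling), the `SU(N)` Wilson specification at tree coupling `N·β` is a Kantorovich contraction with
coefficients `K|β|·n(x,y)` (staple influence count). (The construction inside `dlrMassGap_of_oneLinkKRModulus`, exposed.) -/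
theorem isKRContraction_of_oneLinkKRModulus (hN : 1 ≤ N) {β R K : ℝ} (hK : 0 ≤ K) (hR : |β| * 6 ≤ R) (hmod : OneLinkKRModulus N R K) :
    IsKRContraction (ymSpecification (d := 4) (fundamentalRep (Fin N)) ((N : ℝ) * β)) suFrobDist linkPlaqNbr
      (fun x y => K * |β| * (linkInfluence x y : ℝ)) := by
  classical
  have hR' : |β| * (2 * (((4 : ℕ) : ℝ) - 1)) ≤ R := by norm_num; linarith
  refine isKRContraction_ymSpecification _ (continuous_fundamentalRep (Fin N)) _ (fun x y => by positivity) ?_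
  intro x y _ ω η hωη φ L hφm hφb hL hφL
  rw [siteLaw_ymSpecification_thooft β x ω, siteLaw_ymSpecification_thooft β x η]
  have hBω : matrixOpNorm (stapleField β x ω) ≤ R := (matrixOpNorm_stapleField_le (by norm_num) hN β x ω).trans hR'
  have hBη : matrixOpNorm (stapleField β x η) ≤ R := (matrixOpNorm_stapleField_le (by norm_num) hN β x η).trans hR'
  refine (hmod _ _ hBω hBη φ L hφm hφb hL hφL).trans ?_
  calc K * L * frobNorm (stapleField β x ω - stapleField β x η) ≤ K * L * (|β| * linkInfluence x y * suFrobDist (ω y) (η y)) :=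
        mul_le_mul_of_nonneg_left (frobNorm_stapleField_sub_le β x y hωη) (mul_nonneg hK hL)
    _ = K * |β| * (linkInfluence x y : ℝ) * L * suFrobDist (ω y) (η y) := by ring

/-- Row sums of the coefficients: `Σ_y K|β| n(x,y) ≤ 18 K |β|`. -/
theorem row_sum_of_oneLinkKRModulus {β K : ℝ} (hK : 0 ≤ K) (x : ZdEdge 4) :
    ∑ y ∈ linkPlaqNbr x, K * |β| * (linkInfluence x y : ℝ) ≤ 18 * K * |β| := by
  classical
  rw [← Finset.mul_sum]
  have hsum : ∑ y ∈ linkPlaqNbr x, (linkInfluence x y : ℝ) ≤ 18 := by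
    have h := sum_linkInfluence_le (d := 4) x
    calc ∑ y ∈ linkPlaqNbr x, (linkInfluence x y : ℝ) = ((∑ y ∈ linkPlaqNbr x, linkInfluence x y : ℕ) : ℝ) := by push_cast; rfl
      _ ≤ ((6 * (4 - 1) : ℕ) : ℝ) := by exact_mod_cast h
      _ = 18 := by norm_num
  calc K * |β| * ∑ y ∈ linkPlaqNbr x, (linkInfluence x y : ℝ) ≤ K * |β| * 18 := mul_le_mul_of_nonneg_left hsum (by positivity)
    _ = 18 * K * |β| := by ring

/-- **Ball form of the general-volume influence engine for `SU(N)` from a one-link modulus**: `18K|β| ≤ q`, `0 < q < 1`; exteriors agreeing on the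
exterior links based within sup-distance `m` of `y`; `f` measurable, bounded, depending on `Δ` (links within `ρ₀` of `y`) with Frobenius-Lipschitz
bounds `δ` ⇒ `|∫ f dγ_Λ(·|ω) − ∫ f dγ_Λ(·|η)| ≤ 2√N · q^{m+1−ρ₀} · Σ δ`, ANY finite `Λ`. -/
theorem abs_kerInt_sub_le_of_agree_ball_of_oneLinkKRModulus (hN : 1 ≤ N) {β R K q : ℝ} (hK : 0 ≤ K) (hR : |β| * 6 ≤ R)
    (hmod : OneLinkKRModulus N R K) (hq0 : 0 < q) (hq1 : q < 1) (hβq : 18 * K * |β| ≤ q) (Λ : Finset (ZdEdge 4))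
    (ω η : LGConfig 4 (Matrix.specialUnitaryGroup (Fin N) ℂ)) (y : Fin 4 → ℤ) (m : ℕ)
    (hagree : ∀ z, z ∉ Λ → ⌊‖z.1 - y‖⌋₊ ≤ m → ω z = η z) {f : LGConfig 4 (Matrix.specialUnitaryGroup (Fin N) ℂ) → ℝ}
    (hfm : Measurable f) {Δ : Finset (ZdEdge 4)} (hdep : DependsOn f (↑Δ : Set (ZdEdge 4))) {M : ℝ} (hM : ∀ U, |f U| ≤ M)
    {δ : ZdEdge 4 → ℝ} (hδ : IsLipBound suFrobDist f δ) {ρ₀ : ℕ} (hΔ : ∀ z ∈ Δ, ⌊‖z.1 - y‖⌋₊ ≤ ρ₀) :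
    |(∫ U, f U ∂(ymSpecification (d := 4) (fundamentalRep (Fin N)) ((N : ℝ) * β) Λ ω)) -
        ∫ U, f U ∂(ymSpecification (d := 4) (fundamentalRep (Fin N)) ((N : ℝ) * β) Λ η)| ≤
      2 * Real.sqrt N * q ^ (m + 1 - ρ₀) * ∑ z ∈ Δ, δ z := by
  haveI : SecondCountableTopology (Matrix (Fin N) (Fin N) ℂ) := inferInstanceAs (SecondCountableTopology (Fin N → Fin N → ℂ))
  haveI : SecondCountableTopology (Matrix.specialUnitaryGroup (Fin N) ℂ) := Topology.IsEmbedding.subtypeVal.secondCountableTopology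
  exact KRInfluence.abs_kerInt_sub_le_of_agree_ball_of_isKRContraction (continuous_fundamentalRep (Fin N)) (r := suFrobDist)
    (R := 2 * Real.sqrt N) suFrobDist_nonneg (fun a b => suFrobDist_le a b) (by positivity)
    (isKRContraction_of_oneLinkKRModulus hN hK hR hmod) hq0 hq1 hβq (row_sum_of_oneLinkKRModulus hK) Λ ω η y m hagree hfm hdep hM hδ hΔ

/-! ## §2 The analytic input: the Frobenius-Lipschitz section of the link ratio and its influence bound -/

section Influence

variable {t : ℝ} {w : Fin 4 → ℤ → ℤ} {Y : Finset Cell}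

/-- The section of the link ratio at an exterior `η`, tree coupling `t`: `U ↦ exp(−t(S_{Λ'}(U_{Λ'} ⊕ η^{a←x}) − S_{Λ'}(U_{Λ'} ⊕ η)))`,
`Λ' = innerEdges w Y`. -/
def linkRatioSection (N : ℕ) (t : ℝ) (w : Fin 4 → ℤ → ℤ) (Y : Finset Cell) (a : ZdEdge 4) (x : Matrix.specialUnitaryGroup (Fin N) ℂ)
    (η U : LGConfig 4 (Matrix.specialUnitaryGroup (Fin N) ℂ)) : ℝ :=
  Real.exp (-t * (wilsonBoundaryAction (fundamentalRep (Fin N)) (innerEdges w Y)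
      (glueWith (innerEdges w Y) (fun e : ↥(innerEdges w Y) => U e) (Function.update η a x)) -
    wilsonBoundaryAction (fundamentalRep (Fin N)) (innerEdges w Y) (glueWith (innerEdges w Y) (fun e : ↥(innerEdges w Y) => U e) η)))

/-- The plaquettes of the inner volume through the link `a`. -/
def linkPlaqs (w : Fin 4 → ℤ → ℤ) (Y : Finset Cell) (a : ZdEdge 4) : Finset (ZdPlaquette 4) :=
  (plaquettesTouching (innerEdges w Y)).filter fun p => (plaquetteEdges p ∩ ({a} : Finset (ZdEdge 4))).Nonempty

/-- They are plaquettes through `a`. -/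
theorem linkPlaqs_subset (a : ZdEdge 4) : linkPlaqs w Y a ⊆ plaquettesTouching ({a} : Finset (ZdEdge 4)) := by
  intro p hp
  obtain ⟨e, he⟩ := (Finset.mem_filter.1 hp).2
  rw [Finset.mem_inter, Finset.mem_singleton] at he
  exact mem_plaquettesTouching_singleton.2 (he.2 ▸ he.1)

/-- `#linkPlaqs ≤ 6`. -/
theorem card_linkPlaqs_le (a : ZdEdge 4) : (linkPlaqs w Y a).card ≤ 6 :=
  (Finset.card_le_card (linkPlaqs_subset a)).trans
    ((card_plaquettesTouching_singleton_le a).trans (by norm_num))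

/-- **The section is a Frobenius-Lipschitz cylinder** on the links of the plaquettes through `a`, constant `48N⁴·|t|·e^{12N|t|}`: the RobustBall
boundary-factor certificate with `B = {a}` and `#P ≤ 6`. -/
theorem isLipschitzCylinder_linkRatioSection (a : ZdEdge 4) (x : Matrix.specialUnitaryGroup (Fin N) ℂ)
    (η : LGConfig 4 (Matrix.specialUnitaryGroup (Fin N) ℂ)) :
    IsLipschitzCylinder (fundamentalRep (Fin N)) (linkRatioSection N t w Y a x η) ((linkPlaqs w Y a).biUnion plaquetteEdges)
      ⟨48 * (N : ℝ) ^ 4 * |t| * Real.exp (12 * N * |t|), by positivity⟩ := by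
  classical
  have hη' : ∀ e, e ∉ ({a} : Finset (ZdEdge 4)) → Function.update η a x e = η e := fun e he =>
    Function.update_of_ne (fun h => he (Finset.mem_singleton.2 h)) _ _
  have hP' : ((linkPlaqs w Y a).card : ℝ) ≤ 6 := by exact_mod_cast card_linkPlaqs_le (w := w) (Y := Y) a
  have hK : |t| * Real.exp (|t| * (2 * N * ((linkPlaqs w Y a).card : ℝ))) * (8 * (N : ℝ) ^ 4 * ((linkPlaqs w Y a).card : ℝ)) ≤
      ((⟨48 * (N : ℝ) ^ 4 * |t| * Real.exp (12 * N * |t|), by positivity⟩ : NNReal) : ℝ) := by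
    push_cast
    have he : Real.exp (|t| * (2 * N * ((linkPlaqs w Y a).card : ℝ))) ≤ Real.exp (12 * N * |t|) :=
      Real.exp_le_exp.2 (by nlinarith [abs_nonneg t, Nat.cast_nonneg (α := ℝ) N, mul_nonneg (abs_nonneg t) (Nat.cast_nonneg (α := ℝ) N)])
    have hN4 : 0 ≤ (N : ℝ) ^ 4 := by positivity
    calc |t| * Real.exp (|t| * (2 * N * ((linkPlaqs w Y a).card : ℝ))) * (8 * (N : ℝ) ^ 4 * ((linkPlaqs w Y a).card : ℝ))
        ≤ |t| * Real.exp (12 * N * |t|) * (8 * (N : ℝ) ^ 4 * 6) := by gcongr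
      _ = 48 * (N : ℝ) ^ 4 * |t| * Real.exp (12 * N * |t|) := by ring
  exact suN_isLipschitzCylinder_boundaryFactor (N := N) t (innerEdges w Y) {a} hη' hK

/-- ★ **The influence bound for the link ratio from a one-link modulus.**  For `OneLinkKRModulus N R K`, `|β|·6 ≤ R`, `18K|β| ≤ q`, `0 < q < 1`,
`1 ≤ 2nb`, a link `a` off the inner volume and two exteriors agreeing on the exterior links within sup-distance `2nb` of `a`: the inner-kernel averages
of `linkRatio (fundamentalRep (Fin N)) (N·β) w Y a x` differ by at most `2√N · q^{2nb} · (24 · 48N⁴|Nβ|e^{12N|Nβ|})`. -/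
theorem linkRatio_influence_of_oneLinkKRModulus (hN : 1 ≤ N) {β R K q : ℝ} (hK : 0 ≤ K) (hR : |β| * 6 ≤ R) (hmod : OneLinkKRModulus N R K)
    (hq0 : 0 < q) (hq1 : q < 1) (hβq : 18 * K * |β| ≤ q) {b n : ℕ} (hnb : 1 ≤ 2 * n * b) {a : ZdEdge 4} (haΛ : a ∉ innerEdges w Y)
    (x : Matrix.specialUnitaryGroup (Fin N) ℂ) (ω η : LGConfig 4 (Matrix.specialUnitaryGroup (Fin N) ℂ))
    (hagree : ∀ z : ZdEdge 4, z ∉ innerEdges w Y → ⌊‖z.1 - a.1‖⌋₊ ≤ 2 * n * b → ω z = η z) :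
    |(∫ V, linkRatio (fundamentalRep (Fin N)) ((N : ℝ) * β) w Y a x V
          ∂(ymSpecification (fundamentalRep (Fin N)) ((N : ℝ) * β) (innerEdges w Y) ω)) -
        ∫ V, linkRatio (fundamentalRep (Fin N)) ((N : ℝ) * β) w Y a x V
          ∂(ymSpecification (fundamentalRep (Fin N)) ((N : ℝ) * β) (innerEdges w Y) η)| ≤
      2 * Real.sqrt N * q ^ (2 * n * b) *
        (24 * (48 * (N : ℝ) ^ 4 * |(N : ℝ) * β| * Real.exp (12 * N * |(N : ℝ) * β|))) := by
  classical
  haveI : SecondCountableTopology (Matrix (Fin N) (Fin N) ℂ) := inferInstanceAs (SecondCountableTopology (Fin N → Fin N → ℂ))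
  haveI : SecondCountableTopology (Matrix.specialUnitaryGroup (Fin N) ℂ) := Topology.IsEmbedding.subtypeVal.secondCountableTopology
  have hρ : Continuous (fundamentalRep (Fin N) : Matrix.specialUnitaryGroup (Fin N) ℂ →* _) := continuous_fundamentalRep (Fin N)
  have hγ := isSpecification_ymSpecification_of_t2Space (d := 4)
    (fundamentalRep (Fin N) : Matrix.specialUnitaryGroup (Fin N) ℂ →* _) hρ ((N : ℝ) * β)
  set t : ℝ := (N : ℝ) * β with ht
  set E := linkRatio (fundamentalRep (Fin N)) t w Y a x with hE
  set F := linkRatioSection N t w Y a x η with hF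
  set K' : ℝ := 48 * (N : ℝ) ^ 4 * |t| * Real.exp (12 * N * |t|) with hK'def
  have hK'0 : 0 ≤ K' := by positivity
  have hFL := isLipschitzCylinder_linkRatioSection (t := t) (w := w) (Y := Y) a x η
  set Δ := (linkPlaqs w Y a).biUnion plaquetteEdges with hΔ
  have hΔsub : Δ ⊆ (plaquettesTouching ({a} : Finset (ZdEdge 4))).biUnion plaquetteEdges :=
    Finset.biUnion_subset_biUnion_of_subset_left _ (linkPlaqs_subset a)
  have hA : ∀ u v : Matrix.specialUnitaryGroup (Fin N) ℂ, dist (suEntries u) (suEntries v) ≤ 1 * suFrobDist u v := fun u v => by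
    rw [one_mul]; exact dist_suEntries_le_suFrobDist u v
  have hδ := hFL.isLipBound zero_le_one hA
  -- the engine, applied to the section
  have heng := abs_kerInt_sub_le_of_agree_ball_of_oneLinkKRModulus hN hK hR hmod hq0 hq1 hβq (innerEdges w Y) ω η a.1 (2 * n * b) hagree
    hFL.measurable hFL.dependsOn (M := |F 1| + 2 * ((⟨48 * (N : ℝ) ^ 4 * |t| * Real.exp (12 * N * |t|), by positivity⟩ : NNReal) : ℝ))
    hFL.abs_le hδ (ρ₀ := 1) (fun z hz => floor_norm_le_one_of_mem_plaqNbhd (hΔsub hz))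
  -- the sum of the Lipschitz bounds: `≤ 24 K'`
  have hsum : ∑ z ∈ Δ, (if z ∈ Δ then 1 * (((⟨48 * (N : ℝ) ^ 4 * |t| * Real.exp (12 * N * |t|), by positivity⟩ : NNReal) : ℝ)) else 0) ≤
      24 * K' := by
    rw [Finset.sum_ite_of_true (fun z hz => hz), Finset.sum_const, nsmul_eq_mul]
    have hcard : (Δ.card : ℝ) ≤ 24 := by
      have := (Finset.card_le_card hΔsub).trans (card_plaqNbhd_le a)
      exact_mod_cast this
    have : (1 : ℝ) * (((⟨48 * (N : ℝ) ^ 4 * |t| * Real.exp (12 * N * |t|), by positivity⟩ : NNReal) : ℝ)) = K' := by rw [one_mul]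
    rw [this]
    exact mul_le_mul_of_nonneg_right hcard hK'0
  -- the two integrals of `E` are the two integrals of the section `F`
  have hupd : ∀ (u : ↥(innerEdges w Y) → Matrix.specialUnitaryGroup (Fin N) ℂ) (ζ : LGConfig 4 (Matrix.specialUnitaryGroup (Fin N) ℂ)),
      Function.update (glueWith (innerEdges w Y) u ζ) a x = glueWith (innerEdges w Y) u (Function.update ζ a x) := by
    intro u ζ; funext e
    by_cases hea : e = a
    · subst hea; rw [Function.update_self, glueWith_apply_not_mem _ _ _ haΛ, Function.update_self]
    · rw [Function.update_of_ne hea]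
      by_cases he : e ∈ innerEdges w Y
      · rw [glueWith_apply_mem _ _ _ he, glueWith_apply_mem _ _ _ he]
      · rw [glueWith_apply_not_mem _ _ _ he, glueWith_apply_not_mem _ _ _ he, Function.update_of_ne hea]
  have hEF_glue : ∀ u : ↥(innerEdges w Y) → Matrix.specialUnitaryGroup (Fin N) ℂ,
      E (glueWith (innerEdges w Y) u η) = F (glueWith (innerEdges w Y) u η) := by
    intro u
    have hrestr : (fun e : ↥(innerEdges w Y) => glueWith (innerEdges w Y) u η e) = u := funext fun e => glueWith_apply_mem _ _ _ e.2
    show linkRatio (fundamentalRep (Fin N)) t w Y a x (glueWith (innerEdges w Y) u η) =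
      linkRatioSection N t w Y a x η (glueWith (innerEdges w Y) u η)
    simp only [linkRatio, linkRatioSection, hrestr, hupd]
  have hEη : ∀ V : LGConfig 4 (Matrix.specialUnitaryGroup (Fin N) ℂ), (∀ e ∉ innerEdges w Y, V e = η e) → E V = F V := by
    intro V hV
    have hVg : V = glueWith (innerEdges w Y) (fun e : ↥(innerEdges w Y) => V e) η := by
      funext e
      by_cases he : e ∈ innerEdges w Y
      · rw [glueWith_apply_mem _ _ _ he]
      · rw [glueWith_apply_not_mem _ _ _ he, hV e he]
    rw [hVg]
    exact hEF_glue _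
  have hEω : ∀ V : LGConfig 4 (Matrix.specialUnitaryGroup (Fin N) ℂ), (∀ e ∉ innerEdges w Y, V e = ω e) → E V = F V := by
    intro V hV
    set V' := glueWith (innerEdges w Y) (fun e : ↥(innerEdges w Y) => V e) η with hV'
    have h1 : E V = E V' := by
      refine dependsOn_linkRatio (fundamentalRep (Fin N)) t a x fun e he => ?_
      by_cases heΛ : e ∈ innerEdges w Y
      · rw [hV', glueWith_apply_mem _ _ _ heΛ]
      · rw [hV', glueWith_apply_not_mem _ _ _ heΛ, hV e heΛ]
        exact hagree e heΛ ((floor_norm_le_one_of_mem_plaqNbhd (Finset.mem_coe.1 he)).trans hnb)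
    have h2 : E V' = F V' := hEF_glue _
    have h3 : F V' = F V := by
      have hrestr : (fun e : ↥(innerEdges w Y) => V' e) = fun e : ↥(innerEdges w Y) => V e :=
        funext fun e => by rw [hV', glueWith_apply_mem _ _ _ e.2]
      show linkRatioSection N t w Y a x η V' = linkRatioSection N t w Y a x η V
      simp only [linkRatioSection, hrestr]
    rw [h1, h2, h3]
  have hIω : ∫ V, E V ∂(ymSpecification (fundamentalRep (Fin N)) t (innerEdges w Y) ω) =
      ∫ V, F V ∂(ymSpecification (fundamentalRep (Fin N)) t (innerEdges w Y) ω) :=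
    integral_congr_ae (by filter_upwards [hγ.proper (innerEdges w Y) ω] with V hV; exact hEω V hV)
  have hIη : ∫ V, E V ∂(ymSpecification (fundamentalRep (Fin N)) t (innerEdges w Y) η) =
      ∫ V, F V ∂(ymSpecification (fundamentalRep (Fin N)) t (innerEdges w Y) η) :=
    integral_congr_ae (by filter_upwards [hγ.proper (innerEdges w Y) η] with V hV; exact hEη V hV)
  rw [hIω, hIη]
  refine heng.trans ?_
  have hexp : q ^ (2 * n * b + 1 - 1) = q ^ (2 * n * b) := by rw [Nat.add_sub_cancel]
  rw [hexp]
  exact mul_le_mul_of_nonneg_left hsum (by positivity)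

end Influence

/-! ## §3 The class of record at every mesh from a one-link modulus -/

/-- **THE NUMBER of this file**: the activity radius reached by the `SU(N)` Wilson kernels at tree coupling `t`, Dobrushin rate `q`, mesh `b`,
window `n`: `sunMeshRadius N t q b n = exp(147456 · √N · N⁴ · |t| · e^{24N|t|} · b⁴ · q^{2nb}) − 1` (`147456 = 64 · 2 · 24 · 48`). -/
def sunMeshRadius (N : ℕ) (t q : ℝ) (b n : ℕ) : ℝ :=
  Real.exp (147456 * Real.sqrt N * (N : ℝ) ^ 4 * |t| * Real.exp (24 * N * |t|) * (b : ℝ) ^ 4 * q ^ (2 * n * b)) - 1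

/-- ★★ **STRONG COUPLING AFTER BLOCKING for `SU(N)` from a one-link modulus — class W at EVERY mesh.**  For `OneLinkKRModulus N R K` (`K ≥ 0`),
't Hooft coupling `β` with `|β|·6 ≤ R` and `18K|β| ≤ q`, `0 < q < 1`, every mesh `b ≥ 1` and window `n ≥ 1`:
`BlockedActivityClassW (fundamentalRep (Fin N)) (N·β) b n (sunMeshRadius N (N·β) q b n)`. -/
theorem blockedActivityClassW_mesh_of_oneLinkKRModulus (hN : 1 ≤ N) {β R K q : ℝ} (hK : 0 ≤ K) (hR : |β| * 6 ≤ R)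
    (hmod : OneLinkKRModulus N R K) (hq0 : 0 < q) (hq1 : q < 1) (hβq : 18 * K * |β| ≤ q) {b n : ℕ} (hb : 1 ≤ b) (hn : 1 ≤ n) :
    BlockedActivityClassW (fundamentalRep (Fin N) : Matrix.specialUnitaryGroup (Fin N) ℂ →* _) ((N : ℝ) * β) b n
      (sunMeshRadius N ((N : ℝ) * β) q b n) := by
  have hnb : 1 ≤ 2 * n * b := by nlinarith
  set t : ℝ := (N : ℝ) * β with ht
  have h := blockedActivityClassW_of_influence (Matrix.specialUnitaryGroup (Fin N) ℂ) (fundamentalLatticeRep N) (β := t) (b := b) (n := n)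
    (ι := 2 * Real.sqrt N * q ^ (2 * n * b) * (24 * (48 * (N : ℝ) ^ 4 * |t| * Real.exp (12 * N * |t|)))) (by positivity) hb hn
    fun w _ Y _ _ a ha x ω η hag =>
      linkRatio_influence_of_oneLinkKRModulus hN hK hR hmod hq0 hq1 hβq hnb (not_mem_innerEdges_of_mem_cellEdges w Y ha) x ω η hag
  refine blockedActivityClassW_mono (Matrix.specialUnitaryGroup (Fin N) ℂ) h (le_of_eq ?_)
  unfold sunMeshRadius
  congr 2
  have hNr : (((fundamentalLatticeRep N).N : ℕ) : ℝ) = N := by norm_num [fundamentalLatticeRep]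
  rw [hNr]
  have h2 : Real.exp (12 * N * |t|) * Real.exp (12 * N * |t|) = Real.exp (24 * N * |t|) := by
    rw [← Real.exp_add]; congr 1; ring
  calc 64 * (b : ℝ) ^ 4 * (Real.exp (12 * N * |t|) * (2 * Real.sqrt N * q ^ (2 * n * b) * (24 * (48 * (N : ℝ) ^ 4 * |t| * Real.exp (12 * N * |t|)))))
      = 147456 * Real.sqrt N * (N : ℝ) ^ 4 * |t| * (Real.exp (12 * N * |t|) * Real.exp (12 * N * |t|)) * (b : ℝ) ^ 4 * q ^ (2 * n * b) := by
        ring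
    _ = 147456 * Real.sqrt N * (N : ℝ) ^ 4 * |t| * Real.exp (24 * N * |t|) * (b : ℝ) ^ 4 * q ^ (2 * n * b) := by rw [h2]

/-- … hence the W|Typ class for EVERY class `Typ` at every centre of every mesh-`b` frame. -/
theorem blockedActivityTypWAll_mesh_of_oneLinkKRModulus (hN : 1 ≤ N) {β R K q : ℝ} (hK : 0 ≤ K) (hR : |β| * 6 ≤ R)
    (hmod : OneLinkKRModulus N R K) (hq0 : 0 < q) (hq1 : q < 1) (hβq : 18 * K * |β| ≤ q) {b n : ℕ} (hb : 1 ≤ b) (hn : 1 ≤ n)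
    {w : Fin 4 → ℤ → ℤ} (hw : AfPincerUc.IsFrame b w) (Typ : Cell → Set (LGConfig 4 (Matrix.specialUnitaryGroup (Fin N) ℂ))) :
    BlockedActivityTypWAll (fundamentalRep (Fin N) : Matrix.specialUnitaryGroup (Fin N) ℂ →* _) ((N : ℝ) * β) w n
      (sunMeshRadius N ((N : ℝ) * β) q b n) Typ := fun c₀ =>
  blockedActivityTypW_of_blockedActivityClassW (blockedActivityClassW_mesh_of_oneLinkKRModulus hN hK hR hmod hq0 hq1 hβq hb hn)
    (shiftFrame_mesh hw c₀) _

/-- **RATIO clause (i) for `SU(N)` from a one-link modulus, every mesh, every class.** -/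
theorem ratioClauseI_mesh_of_oneLinkKRModulus (hN : 1 ≤ N) {β R K q : ℝ} (hK : 0 ≤ K) (hR : |β| * 6 ≤ R)
    (hmod : OneLinkKRModulus N R K) (hq0 : 0 < q) (hq1 : q < 1) (hβq : 18 * K * |β| ≤ q) {w : Fin 4 → ℤ → ℤ} {b n : ℕ}
    (hw : AfPincerUc.IsFrame b w) (hb : 1 ≤ b) (hn : 1 ≤ n) (Typ : Cell → Set (LGConfig 4 (Matrix.specialUnitaryGroup (Fin N) ℂ))) :
    RatioClauseI (fundamentalRep (Fin N) : Matrix.specialUnitaryGroup (Fin N) ℂ →* _) ((N : ℝ) * β) w n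
      (64 * (b : ℝ) ^ 4 * (Real.exp (12 * (fundamentalLatticeRep N).N * |(N : ℝ) * β|) *
        (2 * Real.sqrt N * q ^ (2 * n * b) * (24 * (48 * (N : ℝ) ^ 4 * |(N : ℝ) * β| * Real.exp (12 * N * |(N : ℝ) * β|)))))) Typ := by
  have hnb : 1 ≤ 2 * n * b := by nlinarith
  exact ratioClauseI_of_influence (Matrix.specialUnitaryGroup (Fin N) ℂ) (fundamentalLatticeRep N) (by positivity) hw hb hn
    (fun Y _ _ a ha x ω η hag =>
      linkRatio_influence_of_oneLinkKRModulus hN hK hR hmod hq0 hq1 hβq hnb (not_mem_innerEdges_of_mem_cellEdges w Y ha) x ω η hag) Typ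

/-! ## §4 Eventually-in-the-mesh rows, uniformly on a closed sub-window -/

/-- The radius tends to `0` along the meshes, uniformly on `|t| ≤ t₁`: `sunMeshRadius N t q b n ≤ exp(147456 √N N⁴ · t₁ e^{24N t₁} · b⁴ q^{b}) − 1`
(`n ≥ 1`, `0 < q < 1`). -/
theorem sunMeshRadius_le_uniform {t t₁ q : ℝ} (ht : |t| ≤ t₁) (hq0 : 0 < q) (hq1 : q < 1) (b : ℕ) {n : ℕ} (hn : 1 ≤ n) :
    sunMeshRadius N t q b n ≤ Real.exp (147456 * Real.sqrt N * (N : ℝ) ^ 4 * (t₁ * Real.exp (24 * N * t₁)) * ((b : ℝ) ^ 4 * q ^ b)) - 1 := by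
  refine sub_le_sub_right (Real.exp_le_exp.2 ?_) 1
  have ht0 : 0 ≤ t₁ := (abs_nonneg t).trans ht
  have he : |t| * Real.exp (24 * N * |t|) ≤ t₁ * Real.exp (24 * N * t₁) := by
    have h1 : Real.exp (24 * N * |t|) ≤ Real.exp (24 * N * t₁) :=
      Real.exp_le_exp.2 (mul_le_mul_of_nonneg_left ht (by positivity))
    exact mul_le_mul ht h1 (Real.exp_pos _).le ht0
  have hq : q ^ (2 * n * b) ≤ q ^ b := pow_le_pow_of_le_one hq0.le hq1.le (by nlinarith)
  have hb4 : 0 ≤ (b : ℝ) ^ 4 := by positivity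
  have hN0 : 0 ≤ 147456 * Real.sqrt N * (N : ℝ) ^ 4 := by positivity
  calc 147456 * Real.sqrt N * (N : ℝ) ^ 4 * |t| * Real.exp (24 * N * |t|) * (b : ℝ) ^ 4 * q ^ (2 * n * b)
      = 147456 * Real.sqrt N * (N : ℝ) ^ 4 * (|t| * Real.exp (24 * N * |t|)) * ((b : ℝ) ^ 4 * q ^ (2 * n * b)) := by ring
    _ ≤ 147456 * Real.sqrt N * (N : ℝ) ^ 4 * (t₁ * Real.exp (24 * N * t₁)) * ((b : ℝ) ^ 4 * q ^ b) := by gcongr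

/-- ★ **For every radius `a > 0` and every rate `q < 1` the class of record holds for `SU(N)` at ALL large meshes, uniformly on the closed sub-window
`|β| ≤ β₁`** of a one-link modulus door (`β₁·6 ≤ R`, `18K·β₁ ≤ q`; `n ≥ 1` fixed): blocking IMPROVES the activity radius exponentially in the mesh. -/
theorem blockedActivityClassW_eventually_of_oneLinkKRModulus (hN : 1 ≤ N) {R K q β₁ a : ℝ} (hK : 0 ≤ K) (hmod : OneLinkKRModulus N R K)
    (hβ₁R : β₁ * 6 ≤ R) (hβ₁q : 18 * K * β₁ ≤ q) (hq0 : 0 < q) (hq1 : q < 1) (ha : 0 < a) {n : ℕ} (hn : 1 ≤ n) :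
    ∃ b₀ : ℕ, 1 ≤ b₀ ∧ ∀ b : ℕ, b₀ ≤ b → ∀ β : ℝ, |β| ≤ β₁ →
      BlockedActivityClassW (fundamentalRep (Fin N) : Matrix.specialUnitaryGroup (Fin N) ℂ →* _) ((N : ℝ) * β) b n a := by
  have hlim : Filter.Tendsto (fun b : ℕ => (b : ℝ) ^ 4 * q ^ b) Filter.atTop (nhds 0) :=
    tendsto_pow_const_mul_const_pow_of_abs_lt_one 4 (by rw [abs_of_nonneg hq0.le]; exact hq1)
  set t₁ : ℝ := (N : ℝ) * β₁ with ht₁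
  set C : ℝ := 147456 * Real.sqrt N * (N : ℝ) ^ 4 * (t₁ * Real.exp (24 * N * t₁)) with hC
  have hcont : Filter.Tendsto (fun s : ℝ => Real.exp (C * s) - 1) (nhds 0) (nhds (Real.exp (C * 0) - 1)) :=
    ((Real.continuous_exp.comp (continuous_const.mul continuous_id)).sub continuous_const).continuousAt.tendsto
  rw [mul_zero, Real.exp_zero, sub_self] at hcont
  have hev := (hcont.comp hlim).eventually (gt_mem_nhds ha)
  obtain ⟨b₁, hb₁⟩ := Filter.eventually_atTop.1 hev
  refine ⟨max b₁ 1, le_max_right _ _, fun b hb β hβ => ?_⟩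
  have hb1 : 1 ≤ b := (le_max_right _ _).trans hb
  have hβ₁0 : 0 ≤ β₁ := (abs_nonneg β).trans hβ
  have hR : |β| * 6 ≤ R := by nlinarith
  have hβq : 18 * K * |β| ≤ q := by nlinarith
  have ht : |(N : ℝ) * β| ≤ t₁ := by
    rw [abs_mul, abs_of_nonneg (Nat.cast_nonneg N)]; exact mul_le_mul_of_nonneg_left hβ (Nat.cast_nonneg N)
  have hmaj : sunMeshRadius N ((N : ℝ) * β) q b n ≤ a :=
    (sunMeshRadius_le_uniform ht hq0 hq1 b hn).trans (le_of_lt (hb₁ b ((le_max_left _ _).trans hb)))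
  exact blockedActivityClassW_mono (Matrix.specialUnitaryGroup (Fin N) ℂ)
    (blockedActivityClassW_mesh_of_oneLinkKRModulus hN hK hR hmod hq0 hq1 hβq hb1 hn) hmaj

/-- ★ **SCALE AXIS, strong end: the universal shell condition for `SU(N)` at ALL large meshes** uniformly on the closed sub-window `|β| ≤ β₁` of a
one-link modulus door, for every admissible accuracy `0 < ε ≤ 1` and window `n ≥ 1`. -/
theorem univShellCond_eventually_of_oneLinkKRModulus (hN : 1 ≤ N) {R K q β₁ ε : ℝ} (hK : 0 ≤ K) (hmod : OneLinkKRModulus N R K)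
    (hβ₁R : β₁ * 6 ≤ R) (hβ₁q : 18 * K * β₁ ≤ q) (hq0 : 0 < q) (hq1 : q < 1) (hε : 0 < ε) (hε1 : ε ≤ 1) {n : ℕ} (hn : 1 ≤ n) :
    ∃ b₀ : ℕ, 1 ≤ b₀ ∧ ∀ b : ℕ, b₀ ≤ b → ∀ β : ℝ, |β| ≤ β₁ →
      UnivShellCond (fundamentalRep (Fin N) : Matrix.specialUnitaryGroup (Fin N) ℂ →* _) ((N : ℝ) * β) b n ε := by
  obtain ⟨b₀, hb₀, h⟩ := blockedActivityClassW_eventually_of_oneLinkKRModulus hN hK hmod hβ₁R hβ₁q hq0 hq1 (radiusKP_pos hε) hn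
  exact ⟨b₀, hb₀, fun b hb β hβ => univShellCond_of_blockedActivityW_sharp (h b hb β hβ) hε1 le_rfl⟩

/-- ★ **The Uc-mixing meshes are COFINAL for `SU(N)` on the closed sub-window `|β| ≤ β₁` of a one-link modulus door**: format Uc
`TypShellCondUKPc (fundamentalRep (Fin N)) (N·β) b n ε δ` (every `δ`) at all large meshes. -/
theorem typShellCondUKPc_eventually_of_oneLinkKRModulus (hN : 1 ≤ N) {R K q β₁ ε : ℝ} (hK : 0 ≤ K) (hmod : OneLinkKRModulus N R K)
    (hβ₁R : β₁ * 6 ≤ R) (hβ₁q : 18 * K * β₁ ≤ q) (hq0 : 0 < q) (hq1 : q < 1) (hε : 0 < ε) (hε1 : ε ≤ 1) {n : ℕ} (hn : 1 ≤ n) :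
    ∃ b₀ : ℕ, 1 ≤ b₀ ∧ ∀ b : ℕ, b₀ ≤ b → ∀ β : ℝ, |β| ≤ β₁ → ∀ δ : ℝ,
      TypShellCondUKPc (fundamentalRep (Fin N) : Matrix.specialUnitaryGroup (Fin N) ℂ →* _) ((N : ℝ) * β) b n ε δ := by
  obtain ⟨b₀, hb₀, h⟩ := univShellCond_eventually_of_oneLinkKRModulus hN hK hmod hβ₁R hβ₁q hq0 hq1 hε hε1 hn
  exact ⟨b₀, hb₀, fun b hb β hβ δ => typShellCondUKPc_of_univShellCond (h b hb β hβ) δ⟩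

end SUN

end Summit.QuantumFields.YangMills.Cruxes.IR.BlockedActivity

end
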